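import Summits.Ventures.QEC.CircuitDistance.SchedLeafDefsBB144o345
import Summits.Ventures.QEC.CircuitDistance.TransportBB144o345
import Summits.Ventures.QEC.CircuitDistance.PortLeafRelabel
import HarnessLib

/-!
# β LEAF TRANSPORT for order #345 of `[[144,12,12]]` (Q4 lane, director-qec R160 (2) / R162 (1)(a); venture QEC, experiment cell CDX;
# seat qec-cdx-idea-2 g3 on g2's D2/D3; nothing here asserts a value of `d_circ`)

The `Z`-sector leaf list of #345 is obtained from the `X`-sector leaf list WITHOUT replaying any `Z` UNSAT / null-split certificate:
for an `X` entry `e` the TRANSPORTED entry `transportEntry345 e` has word `e.word.map dualQ` (`L g ↦ R(−g)`, `R g ↦ L(−g)`) and leaf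
`e.leaf.relabel (phiDet 12 6 10)` (detector `(layer s, check j) ↦ (10 − s, −j)`; groups / nulls / CNF rows / `us` / `w` unchanged), so
* `¬ Realised` is TRANSPORTED by the landed `Fibre.Leaf.not_realised_relabel` (idea-2 g2 D2, p688073) from the `X` entry's own
  `¬ Realised`, given injectivity of Φ on the leaf's detectors — here from `phi345_injOn` (Φ is injective below `792 = 11·72`) and the
  LINEAR bound check `detBound345` (the landed `injOnB` evaluates a quadratic `dedup`, too heavy in the kernel for 810-coordinate leaves);
* `word.Nodup` follows from the `X` word's by `dualQ_injective`; `w = 10` and `budget ≤ 1` are definitionally the `X` leaf's;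
* WELL-FORMEDNESS is transported too: `Fibre.Leaf.wf_relabel` (new here, generic): `L.injOnB φ → L.wf → (L.relabel φ).wf` (the admissible
  detector rows are permuted among themselves; note the fast check `wfFast` is NOT preserved — it assumes rows indexed by detector number —
  and is not needed);
* the ONE remaining `Z`-side obligation — COVERAGE `o345ZTable.covers₂` of the dual word by the relabelled coordinates — is a `decide +kernel`
  per leaf (the same cost as the `X` entry's `covers₂`; that it passes is idea-2 g2's D1 evidence: Φ is an exact symmetry of the #345 DEM in
  the `N₀ = 10` window, cf. type-2's `o345_classDual`); with `detBound345` it is bundled as `zTransportChecks345 e`.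
Then `transport345_wordsDual : WordsDual LX (LX.map transportEntry345)` holds BY CONSTRUCTION (translation `0`), so type-2's
`sched345_circuitDistance_eq_eleven_of_k2X` specialises to **`sched345_circuitDistance_eq_eleven_of_xLeaves`**: the #345 value
`∀ N_c ≥ 1, circuitDistanceₛ sched345 bb144SM N_c = 11` from (i) the `X` leaf facts `LeafOK345X`, (ii) the per-leaf Boolean transport checks,
(iii) the `X`-sector W = 10 completeness binder `K2X` — no `Z` leaf list, no `Z` completeness, no `Z` replay (≈ 115 files / ≈ 3 farm-h saved
per eng-1's estimate). Per-leaf companion files: `theorem eZt_NNN_ok : LeafOK345Z (transportEntry345 eX_NNN) := zentry345_ok_of_checks eX_NNN_ok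
(by decide +kernel)` (or the two checks separately via `zentry345_ok_of_transport`). std axioms only; no `native_decide`.
Idea-2's DEM is not the word of record; nothing here changes a deployed code.
-/

namespace Summit.Ventures.QEC.CircuitDistance

open Literature.InformationTheory.QuantumCodes

namespace Fibre

/-! ## Well-formedness is transported by an injective relabelling (generic; complements `PortLeafRelabel`) -/

/-- Relabelling keeps `n`. -/
@[simp] theorem Leaf.relabel_n (L : Leaf) (φ : ℕ → ℕ) : (L.relabel φ).n = L.n := rfl
/-- Relabelling keeps the CNF rows. -/
@[simp] theorem Leaf.relabel_rows (L : Leaf) (φ : ℕ → ℕ) : (L.relabel φ).rows = L.rows := rfl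
/-- Relabelling keeps `us`. -/
@[simp] theorem Leaf.relabel_us (L : Leaf) (φ : ℕ → ℕ) : (L.relabel φ).us = L.us := rfl

/-- A detector of `L` is, after relabelling, a detector of the relabelled leaf. -/
theorem Leaf.mem_detectors_relabel (L : Leaf) (φ : ℕ → ℕ) {d : ℕ} (hd : d ∈ L.coords.flatten) :
    φ d ∈ (L.relabel φ).detectors := by
  unfold Leaf.detectors
  rw [List.mem_dedup, Leaf.relabel_coords, List.mem_flatten]
  obtain ⟨l, hl, hdl⟩ := List.mem_flatten.1 hd
  exact ⟨l.map φ, List.mem_map.2 ⟨l, hl, rfl⟩, List.mem_map.2 ⟨d, hdl, rfl⟩⟩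

/-- Under an injective relabelling the detector row of `φ d` is the detector row of `d`. -/
theorem Leaf.detRow_relabel {L : Leaf} {φ : ℕ → ℕ} (h : L.injOnB φ = true) {d : ℕ} (hd : d ∈ L.coords.flatten) :
    (L.relabel φ).detRow (φ d) = L.detRow d := by
  unfold Leaf.detRow
  rw [Leaf.relabel_n]
  refine List.filter_congr fun c _ => ?_
  rw [decide_eq_decide]
  exact L.mem_coordsOf_relabel_iff h hd c

/-- Admissible rows stay admissible under an injective relabelling. -/
theorem Leaf.admissible_relabel {L : Leaf} {φ : ℕ → ℕ} (h : L.injOnB φ = true) {a : List ℕ} (ha : a ∈ L.admissible) :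
    a ∈ (L.relabel φ).admissible := by
  unfold Leaf.admissible at ha ⊢
  rcases List.mem_append.1 ha with ha | ha
  · obtain ⟨d, hd, rfl⟩ := List.mem_map.1 ha
    have hd' : d ∈ L.coords.flatten := by unfold Leaf.detectors at hd; exact List.mem_dedup.1 hd
    exact List.mem_append.2 (Or.inl (List.mem_map.2 ⟨φ d, L.mem_detectors_relabel φ hd', L.detRow_relabel h hd'⟩))
  · exact List.mem_append.2 (Or.inr ha)

/-- **Well-formedness is preserved by an injective relabelling** (so a transported leaf needs no `wf` re-check). -/
theorem Leaf.wf_relabel (L : Leaf) (φ : ℕ → ℕ) (hφ : L.injOnB φ = true) (h : L.wf = true) : (L.relabel φ).wf = true := by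
  unfold Leaf.wf at h ⊢
  simp only [Bool.and_eq_true, List.all_eq_true, List.any_eq_true] at h ⊢
  obtain ⟨⟨⟨⟨⟨h1, h2⟩, h3⟩, h4⟩, h5⟩, h6⟩ := h
  refine ⟨⟨⟨⟨⟨h1, h2⟩, h3⟩, fun r hr => ?_⟩, h5⟩, h6⟩
  obtain ⟨a, ha, hpa⟩ := h4 r hr
  exact ⟨a, L.admissible_relabel hφ ha, hpa⟩

end Fibre

/-- `Φ` on encoded detectors for the #345 window `N₀ = 10`: `encDet (s, j) ↦ encDet (10 − s, −j)`. -/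
def phi345 (d : ℕ) : ℕ := phiDet 12 6 10 d

/-- Every number below `(N₀+1)·ℓm = 792` encodes a window detector `(s, j)` with `s ≤ 10`. -/
theorem exists_encDet_of_lt_792 {d : ℕ} (hd : d < 792) : ∃ s, s ≤ 10 ∧ ∃ j : BB.Mono 12 6, d = encDet (s, j) := by
  refine ⟨d / 72, by omega, (BB.Code.checkIndex (ℓ := 12) (m := 6)).symm ⟨d % 72, Nat.mod_lt _ (by norm_num)⟩, ?_⟩
  unfold encDet
  rw [Equiv.apply_symm_apply]
  show d = d / 72 * (12 * 6) + d % 72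
  omega

/-- **`Φ` is injective on the window detectors `< 792`** (so `injOnB` needs no quadratic `dedup` evaluation in the kernel — only the linear
bound check `detBound345`). -/
theorem phi345_injOn {a b : ℕ} (ha : a < 792) (hb : b < 792) (h : phi345 a = phi345 b) : a = b := by
  obtain ⟨s, hs, j, rfl⟩ := exists_encDet_of_lt_792 ha
  obtain ⟨t, ht, k, rfl⟩ := exists_encDet_of_lt_792 hb
  unfold phi345 at h
  rw [phiDet_encDet, phiDet_encDet] at h
  have h' := Prod.ext_iff.1 (encDet_injective h)
  have hst : s = t := by have := h'.1; simp only at this; omega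
  have hjk : j = k := neg_injective (by simpa using h'.2)
  subst hst; subst hjk; rfl

/-- Linear kernel check: all detector numbers of the leaf are window detectors (`< 792`). -/
def detBound345 (e : LeafEntry 12 6) : Bool := e.leaf.coords.flatten.all fun d => decide (d < 792)

/-- `injOnB` from an injectivity domain bound (generic). -/
theorem Fibre.Leaf.injOnB_of_injOn (L : Fibre.Leaf) (φ : ℕ → ℕ) (B : ℕ) (hφ : ∀ a b, a < B → b < B → φ a = φ b → a = b)
    (hB : (L.coords.flatten.all fun d => decide (d < B)) = true) : L.injOnB φ = true := by
  unfold Fibre.Leaf.injOnB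
  rw [decide_eq_true_eq]
  rw [List.all_eq_true] at hB
  refine List.Nodup.map_on ?_ (List.nodup_dedup _)
  intro x hx y hy hxy
  exact hφ x y (of_decide_eq_true (hB x (List.mem_dedup.1 hx))) (of_decide_eq_true (hB y (List.mem_dedup.1 hy))) hxy

/-- `injOnB phi345` from the bound check. -/
theorem injOnB_phi345_of_detBound {e : LeafEntry 12 6} (h : detBound345 e = true) : e.leaf.injOnB phi345 = true :=
  Fibre.Leaf.injOnB_of_injOn e.leaf phi345 792 (fun _ _ ha hb hab => phi345_injOn ha hb hab) h

/-- The TRANSPORTED (`Z`-sector) entry of an `X`-sector entry of #345: dual word, `Φ`-relabelled leaf. -/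
def transportEntry345 (e : LeafEntry 12 6) : LeafEntry 12 6 :=
  ⟨e.word.map Transport.dualQ, e.leaf.relabel phi345⟩

/-- The word of the transported entry is the dual word. -/
@[simp] theorem transportEntry345_word (e : LeafEntry 12 6) : (transportEntry345 e).word = e.word.map Transport.dualQ := rfl
/-- The leaf of the transported entry is the relabelled leaf. -/
@[simp] theorem transportEntry345_leaf (e : LeafEntry 12 6) : (transportEntry345 e).leaf = e.leaf.relabel phi345 := rfl

/-- The per-leaf `Z`-side Boolean checks of the transport: coverage of the dual word against the landed `o345ZTable` at `N_c = 10`, and the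
linear detector bound (`< 792`) that gives injectivity of `Φ` on the leaf's detectors (`injOnB` itself evaluates a quadratic `dedup` — avoided). -/
def zTransportChecks345 (e : LeafEntry 12 6) : Bool :=
  o345ZTable.covers₂ bb144SM 10 (transportEntry345 e) && detBound345 e

/-- **One transported entry is a valid `Z` entry of #345**, from the `X` entry's bundle and the two `Z`-side checks (well-formedness is
transported by `Leaf.wf_relabel`, unrealisability by `Leaf.not_realised_relabel`, `Nodup` by `dualQ_injective`; `w`, `budget` are the `X` leaf's). -/
theorem zentry345_ok_of_transport {e : LeafEntry 12 6} (hX : LeafOK345X e)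
    (hcov : o345ZTable.covers₂ bb144SM 10 (transportEntry345 e) = true) (hinj : e.leaf.injOnB phi345 = true) :
    LeafOK345Z (transportEntry345 e) := by
  obtain ⟨hwf, -, hnd, hw, hb, hnr⟩ := hX
  exact zentry345_ok_of (Fibre.Leaf.wf_relabel e.leaf phi345 hinj hwf) hcov (hnd.map Transport.dualQ_injective)
    (by simpa using hw) (by simpa using hb) (Fibre.Leaf.not_realised_relabel e.leaf phi345 hinj hnr)

/-- The same from the bundled Boolean check. -/
theorem zentry345_ok_of_checks {e : LeafEntry 12 6} (hX : LeafOK345X e) (h : zTransportChecks345 e = true) :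
    LeafOK345Z (transportEntry345 e) := by
  simp only [zTransportChecks345, Bool.and_eq_true] at h
  exact zentry345_ok_of_transport hX h.1 (injOnB_phi345_of_detBound h.2)

/-- All transported entries are valid `Z` entries. -/
theorem transport345_hZ (LX : List (LeafEntry 12 6)) (hX : ∀ e ∈ LX, LeafOK345X e)
    (hchk : ∀ e ∈ LX, zTransportChecks345 e = true) : ∀ e ∈ LX.map transportEntry345, LeafOK345Z e := by
  intro e he
  obtain ⟨e₀, he₀, rfl⟩ := List.mem_map.1 he
  exact zentry345_ok_of_checks (hX e₀ he₀) (hchk e₀ he₀)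

/-- `trQ 0 = id` (as in `K2Inst.trQ_zero'`, restated here to keep this file's imports to the #345 chain). -/
theorem trQ_zero_eq (s : Finset (BB.Mono 12 6 ⊕ BB.Mono 12 6)) : trQ (0 : BB.Mono 12 6) s = s := by
  ext q; rw [mem_trQ]
  rcases q with i | i
  · rw [translate_symm_inl, neg_zero, add_zero]
  · rw [translate_symm_inr, neg_zero, add_zero]

/-- `WordsDual` holds BY CONSTRUCTION for the transported list (translation `0`). -/
theorem transport345_wordsDual (LX : List (LeafEntry 12 6)) : Transport.WordsDual LX (LX.map transportEntry345) := by
  intro e he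
  refine ⟨transportEntry345 e, List.mem_map.2 ⟨e, he, rfl⟩, 0, ?_⟩
  have h0 : (trQ (0 : BB.Mono 12 6)) = id := funext trQ_zero_eq
  simp [h0]

/-- **β: both sector exclusions of #345 from the `X` leaves alone** (+ transport checks + `X` completeness). -/
theorem sched345_sectors_of_xLeaves (LX : List (LeafEntry 12 6)) (hX : ∀ e ∈ LX, LeafOK345X e)
    (hchk : ∀ e ∈ LX, zTransportChecks345 e = true) (hK : Transport.K2X bb144SM o345XTable 10 LX) :
    (¬ ∃ F : Finset (Fault 12 6), Gen.Undetectable bb144SM 10 (allEventsₛ sched345 10) F ∧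
        Gen.dataX bb144SM (allEventsₛ sched345 10) F ∉ rowSpace bb144SM.toCode.HX ∧ faultCount F ≤ 10) ∧
    (¬ ∃ F : Finset (Fault 12 6), Gen.Undetectable bb144SM 10 (allEventsₛ sched345 10) F ∧
        Gen.dataZ bb144SM (allEventsₛ sched345 10) F ∉ rowSpace bb144SM.toCode.HZ ∧ faultCount F ≤ 10) :=
  sched345_sectors_of_k2X LX (LX.map transportEntry345) (fun e he => hX e he) (transport345_hZ LX hX hchk)
    (transport345_wordsDual LX) hK

/-- ★ **β: THE #345 VALUE from the `X` leaves alone** — `∀ N_c ≥ 1, circuitDistanceₛ sched345 bb144SM N_c = 11`, conditional on the `X` leaf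
facts, the per-leaf transport checks and the `X`-sector W = 10 completeness binder (implication; nothing asserted). -/
theorem sched345_circuitDistance_eq_eleven_of_xLeaves (LX : List (LeafEntry 12 6)) (hX : ∀ e ∈ LX, LeafOK345X e)
    (hchk : ∀ e ∈ LX, zTransportChecks345 e = true) (hK : Transport.K2X bb144SM o345XTable 10 LX) :
    ∀ Nc : ℕ, 1 ≤ Nc → circuitDistanceₛ sched345 bb144SM Nc = 11 :=
  sched345_circuitDistance_eq_eleven_of_k2X LX (LX.map transportEntry345) (fun e he => hX e he) (transport345_hZ LX hX hchk)
    (transport345_wordsDual LX) hK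

/-- List form of the per-leaf checks: a `List.all` certificate (one `decide +kernel` per companion file, or per chunk) gives `hchk`. -/
theorem zTransportChecks345_of_all (LX : List (LeafEntry 12 6)) (h : LX.all zTransportChecks345 = true) :
    ∀ e ∈ LX, zTransportChecks345 e = true := fun e he => List.all_eq_true.1 h e he

end Summit.Ventures.QEC.CircuitDistance
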